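import Summits.Parity.GeneralizedHardyLittlewood.Theorems.LiouvilleShiftedTablesSieveToMAvgPieceBound

/-!
# Sieve glue for `SieveToMAvg`, part 10a: the core sums — splitting

Support file for item stmt-Parity-14274 (route `LiouvilleShiftedTables`).  The core quantity is

  `CoreSum h Q X = ∑_{q ≤ Q} |T(X; q, h)|`,  `T(X; q, h) = ∑_{h < n ≤ X, n ≡ h (q)} Λ(n) λ(n − h)`.

Moduli not coprime to `h` see only prime powers of the primes dividing `(q, h)`
(`abs_Tcorr_le_of_not_coprime`); for the coprime ones, `(h, X]` is cut into an initial segment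
`(h, X/2^{k₀}]` (bounded by `∑ Λ(n) τ(n−h)`) and the dyadic ranges `(X/2^{k+1}, X/2^k]`, on which
`T` is the correlation functional `TT` of part 1 applied to `Λ` (`CoreSum_le_split`).
-/

namespace Summit.Parity.GeneralizedHardyLittlewood.Theorems.SieveToMAvg

open Finset Real
open scoped ArithmeticFunction.zeta ArithmeticFunction.sigma ArithmeticFunction.vonMangoldt
open Literature.NumberTheory.Sieve.BFI

/-- `T(X; q, h) = ∑_{h < n ≤ X, n ≡ h (mod q)} Λ(n) λ(n − h)`. [folklore] -/
noncomputable def Tcorr (h q : ℕ) (X : ℝ) : ℝ :=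
  ∑ n ∈ (Ioc h ⌊X⌋₊).filter (fun n : ℕ => n ≡ h [MOD q]), (Λ n : ℝ) * lamW h n

/-- `CoreSum h Q X = ∑_{1 ≤ q ≤ Q} |T(X; q, h)|`. [folklore] -/
noncomputable def CoreSum (h Q : ℕ) (X : ℝ) : ℝ := ∑ q ∈ Icc 1 Q, |Tcorr h q X|

/-! ### Moduli not coprime to `h` -/

/-- If `g ∣ n`, `2 ≤ g`, `g ∣ h₀` with `1 ≤ h₀`, and `Λ(n) ≠ 0`, then `n` is a power of a prime
`p ≤ h₀` with exponent `≤ log₂ n`. [folklore] -/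
theorem primePow_data_of_dvd {g h₀ n : ℕ} (hg : 2 ≤ g) (hgh : g ∣ h₀) (hh : 1 ≤ h₀) (hgn : g ∣ n)
    (hΛ : (Λ n : ℝ) ≠ 0) :
    n.minFac ≤ h₀ ∧ n.factorization n.minFac ≤ Nat.log 2 n ∧
      n.minFac ^ n.factorization n.minFac = n := by
  have hpp : IsPrimePow n := by
    rw [ArithmeticFunction.vonMangoldt_ne_zero_iff] at hΛ
    · exact hΛ
  have heq := hpp.minFac_pow_factorization_eq
  have hp : n.minFac.Prime := Nat.minFac_prime hpp.ne_one
  refine ⟨?_, ?_, heq⟩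
  · -- the prime `p = minFac n` divides `g`: `g ∣ p^k`, `g ≥ 2`
    have hgpk : g ∣ n.minFac ^ n.factorization n.minFac := by rwa [heq]
    obtain ⟨i, -, hi⟩ := (Nat.dvd_prime_pow hp).1 hgpk
    have hi1 : 1 ≤ i := by
      by_contra h0; push Not at h0
      have : i = 0 := by omega
      rw [this, pow_zero] at hi; omega
    have hpg : n.minFac ∣ g := by rw [hi]; exact dvd_pow_self _ (by omega)
    exact (Nat.le_of_dvd (by omega) (hpg.trans hgh))
  · -- `2^k ≤ p^k = n`
    have h2 : 2 ^ n.factorization n.minFac ≤ n := by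
      calc 2 ^ n.factorization n.minFac ≤ n.minFac ^ n.factorization n.minFac :=
            Nat.pow_le_pow_left hp.two_le _
        _ = n := heq
    exact Nat.le_log_of_pow_le (by norm_num) h2

/-- **Non-coprime moduli**: for `1 ≤ h`, `q` with `(q, h) ≠ 1`,
`|T(X; q, h)| ≤ h (log₂⌊X⌋ + 1) log X` (`X ≥ 1`). [folklore] -/
theorem abs_Tcorr_le_of_not_coprime {h q : ℕ} (hh : 1 ≤ h) (hq : ¬ Nat.Coprime q h) {X : ℝ} (hX : 1 ≤ X) :
    |Tcorr h q X| ≤ h * (Nat.log 2 ⌊X⌋₊ + 1) * Real.log X := by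
  classical
  set N := ⌊X⌋₊ with hN
  set g := Nat.gcd q h with hgdef
  have hg2 : 2 ≤ g := by
    have hg0 : g ≠ 0 := by rw [hgdef]; exact Nat.gcd_ne_zero_right (by omega)
    have hg1 : g ≠ 1 := hq
    omega
  have hgh : g ∣ h := Nat.gcd_dvd_right q h
  have hgq : g ∣ q := Nat.gcd_dvd_left q h
  -- reduce to the nonzero terms, all of which are prime powers `p^k`, `p ≤ h`, `k ≤ log₂ N`
  set S := ((Ioc h N).filter (fun n : ℕ => n ≡ h [MOD q])).filter (fun n => (Λ n : ℝ) ≠ 0) with hS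
  have hgn : ∀ n ∈ S, g ∣ n := by
    intro n hn
    simp only [hS, Finset.mem_filter] at hn
    have hmod : n ≡ h [MOD q] := hn.1.2
    have h1 : n ≡ h [MOD g] := Nat.ModEq.of_dvd hgq hmod
    exact (Nat.modEq_iff_dvd' (by have := (Finset.mem_Ioc.1 hn.1.1).1; omega)).1 h1.symm |> fun hd => by
      -- `g ∣ n - h` and `g ∣ h`
      have : g ∣ n - h + h := Nat.dvd_add hd hgh
      rwa [Nat.sub_add_cancel (by have := (Finset.mem_Ioc.1 hn.1.1).1; omega)] at this
  have hbound : |Tcorr h q X| ≤ ∑ n ∈ S, Real.log X := by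
    unfold Tcorr
    calc |∑ n ∈ (Ioc h N).filter (fun n : ℕ => n ≡ h [MOD q]), (Λ n : ℝ) * lamW h n|
        ≤ ∑ n ∈ (Ioc h N).filter (fun n : ℕ => n ≡ h [MOD q]), |(Λ n : ℝ) * lamW h n| :=
          Finset.abs_sum_le_sum_abs _ _
      _ ≤ ∑ n ∈ (Ioc h N).filter (fun n : ℕ => n ≡ h [MOD q]), (Λ n : ℝ) := by
          refine Finset.sum_le_sum fun n _ => ?_
          rw [abs_mul, abs_of_nonneg ArithmeticFunction.vonMangoldt_nonneg]
          exact mul_le_of_le_one_right ArithmeticFunction.vonMangoldt_nonneg (abs_lamW_le_one h n)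
      _ = ∑ n ∈ S, (Λ n : ℝ) := by rw [hS, Finset.sum_filter_ne_zero]
      _ ≤ ∑ n ∈ S, Real.log X := by
          refine Finset.sum_le_sum fun n hn => ?_
          simp only [hS, Finset.mem_filter, Finset.mem_Ioc] at hn
          have hn1 : (1 : ℝ) ≤ n := by exact_mod_cast (show 1 ≤ n by omega)
          have hnX : (n : ℝ) ≤ X := le_trans (by exact_mod_cast hn.1.1.2) (Nat.floor_le (by linarith))
          exact ArithmeticFunction.vonMangoldt_le_log.trans (Real.log_le_log (by linarith) hnX)
  refine hbound.trans ?_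
  rw [Finset.sum_const, nsmul_eq_mul]
  refine mul_le_mul_of_nonneg_right ?_ (Real.log_nonneg hX)
  -- count `S` through the injection `n ↦ (minFac n, factorization n (minFac n))`
  have hmaps : ∀ n ∈ S, (n.minFac, n.factorization n.minFac) ∈ (Icc 1 h) ×ˢ (Finset.range (Nat.log 2 N + 1)) := by
    intro n hn
    have hn' := hn
    simp only [hS, Finset.mem_filter, Finset.mem_Ioc] at hn'
    obtain ⟨h1, h2, -⟩ := primePow_data_of_dvd hg2 hgh hh (hgn n hn) hn'.2
    rw [Finset.mem_product, Finset.mem_Icc, Finset.mem_range]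
    refine ⟨⟨Nat.minFac_pos n, h1⟩, Nat.lt_succ_of_le (h2.trans (Nat.log_mono_right hn'.1.1.2))⟩
  have hinj : Set.InjOn (fun n => (n.minFac, n.factorization n.minFac)) (S : Set ℕ) := by
    intro n hn m hm heq
    have hn' := Finset.mem_coe.1 hn
    have hm' := Finset.mem_coe.1 hm
    simp only [hS, Finset.mem_filter] at hn' hm'
    obtain ⟨-, -, en⟩ := primePow_data_of_dvd hg2 hgh hh (hgn n (Finset.mem_coe.1 hn)) hn'.2
    obtain ⟨-, -, em⟩ := primePow_data_of_dvd hg2 hgh hh (hgn m (Finset.mem_coe.1 hm)) hm'.2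
    simp only [Prod.mk.injEq] at heq
    calc n = n.minFac ^ n.factorization n.minFac := en.symm
      _ = m.minFac ^ m.factorization m.minFac := by rw [heq.2, heq.1]
      _ = m := em
  have hcard := Finset.card_le_card_of_injOn _ hmaps hinj
  rw [Finset.card_product, Nat.card_Icc, Finset.card_range, Nat.add_sub_cancel] at hcard
  calc (S.card : ℝ) ≤ ((h * (Nat.log 2 N + 1) : ℕ) : ℝ) := by exact_mod_cast hcard
    _ = h * (Nat.log 2 N + 1) := by push_cast; ring

/-! ### The dyadic split of `(h, X]` -/

/-- Splitting `∑_{h < n ≤ ⌊X⌋}` into `∑_{h < n ≤ ⌊X/2^{k₀}⌋}` and the dyadic blocks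
`(⌊X/2^{k+1}⌋, ⌊X/2^k⌋]`, `k < k₀` (`h ≤ ⌊X/2^{k₀}⌋`, `X ≥ 0`). [folklore] -/
theorem sum_Ioc_dyadic_split (f : ℕ → ℝ) {X : ℝ} (hX : 0 ≤ X) (h : ℕ) :
    ∀ k₀ : ℕ, h ≤ ⌊X / 2 ^ k₀⌋₊ →
      ∑ n ∈ Ioc h ⌊X⌋₊, f n = ∑ n ∈ Ioc h ⌊X / 2 ^ k₀⌋₊, f n +
        ∑ k ∈ Finset.range k₀, ∑ n ∈ Ioc ⌊X / 2 ^ (k + 1)⌋₊ ⌊X / 2 ^ k⌋₊, f n := by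
  intro k₀
  induction k₀ with
  | zero => intro _; simp
  | succ k₀ ih =>
    intro hh
    have hmono : ⌊X / 2 ^ (k₀ + 1)⌋₊ ≤ ⌊X / 2 ^ k₀⌋₊ := by
      refine Nat.floor_le_floor (div_le_div_of_nonneg_left hX (by positivity) ?_)
      exact pow_le_pow_right₀ (by norm_num) (Nat.le_succ k₀)
    rw [ih (hh.trans hmono), Finset.sum_range_succ, ← Finset.sum_Ioc_consecutive f hh hmono]
    ring

/-- The initial segment `Init_q = ∑_{h < n ≤ N₀, n ≡ h (q)} Λ(n) λ(n − h)`. [folklore] -/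
noncomputable def InitSum (h q N₀ : ℕ) : ℝ :=
  ∑ n ∈ (Ioc h N₀).filter (fun n : ℕ => n ≡ h [MOD q]), (Λ n : ℝ) * lamW h n

/-- **`T` = initial segment + dyadic correlation sums**: for `h ≤ ⌊X/2^{k₀}⌋`, `X ≥ 0`,
`T(X; q, h) = Init_q(⌊X/2^{k₀}⌋) + ∑_{k<k₀} corr_q at scale X/2^{k+1}`. [folklore] -/
theorem Tcorr_eq_init_add (h q : ℕ) {X : ℝ} (hX : 0 ≤ X) {k₀ : ℕ} (hh : h ≤ ⌊X / 2 ^ k₀⌋₊) :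
    Tcorr h q X = InitSum h q ⌊X / 2 ^ k₀⌋₊ +
      ∑ k ∈ Finset.range k₀, corr (lamW h) h q (X / 2 ^ (k + 1)) (fun n => (Λ n : ℝ)) := by
  unfold Tcorr InitSum corr dyadClass
  rw [Finset.sum_filter, Finset.sum_filter, sum_Ioc_dyadic_split _ hX h k₀ hh]
  congr 1
  refine Finset.sum_congr rfl fun k _ => ?_
  rw [Finset.sum_filter, show 2 * (X / 2 ^ (k + 1)) = X / 2 ^ k by rw [pow_succ]; field_simp]

/-- **The initial segments over the moduli**: `∑_{q ≤ Q, (q,h)=1} |Init_q(N₀)| ≤ ∑_{h < n ≤ N₀} τ(n−h) Λ(n)`. [folklore] -/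
theorem sum_abs_InitSum_le (h Q N₀ : ℕ) :
    ∑ q ∈ moduli Q h, |InitSum h q N₀| ≤ ∑ n ∈ Ioc h N₀, (σ 0 (n - h) : ℝ) * Λ n := by
  calc ∑ q ∈ moduli Q h, |InitSum h q N₀|
      ≤ ∑ q ∈ moduli Q h, ∑ n ∈ (Ioc h N₀).filter (fun n : ℕ => n ≡ h [MOD q]), (Λ n : ℝ) := by
        refine Finset.sum_le_sum fun q _ => (Finset.abs_sum_le_sum_abs _ _).trans (Finset.sum_le_sum fun n _ => ?_)
        rw [abs_mul, abs_of_nonneg ArithmeticFunction.vonMangoldt_nonneg]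
        exact mul_le_of_le_one_right ArithmeticFunction.vonMangoldt_nonneg (abs_lamW_le_one h n)
    _ = ∑ n ∈ Ioc h N₀, (((moduli Q h).filter (fun q => n ≡ h [MOD q])).card : ℝ) * Λ n := by
        simp_rw [Finset.sum_filter]
        rw [Finset.sum_comm]
        refine Finset.sum_congr rfl fun n _ => ?_
        rw [Finset.card_filter, Nat.cast_sum, Finset.sum_mul]
        refine Finset.sum_congr rfl fun q _ => ?_
        split_ifs <;> simp
    _ ≤ ∑ n ∈ Ioc h N₀, (σ 0 (n - h) : ℝ) * Λ n := by
        refine Finset.sum_le_sum fun n hn => mul_le_mul_of_nonneg_right ?_ ArithmeticFunction.vonMangoldt_nonneg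
        exact_mod_cast card_moduli_filter_modEq_le (Finset.mem_Ioc.1 hn).1

/-- **Splitting the core sum**: for `1 ≤ h ≤ ⌊X/2^{k₀}⌋`, `X ≥ 1`,
`CoreSum h Q X ≤ Q h (log₂⌊X⌋+1) log X + ∑_{h<n≤X/2^{k₀}} τ(n−h)Λ(n) + ∑_{k<k₀} TT_{X/2^{k+1}}(Λ)`. [folklore] -/
theorem CoreSum_le_split {h : ℕ} (hh : 1 ≤ h) (Q : ℕ) {X : ℝ} (hX : 1 ≤ X) {k₀ : ℕ} (hk₀ : h ≤ ⌊X / 2 ^ k₀⌋₊) :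
    CoreSum h Q X ≤ Q * (h * (Nat.log 2 ⌊X⌋₊ + 1) * Real.log X) +
      ∑ n ∈ Ioc h ⌊X / 2 ^ k₀⌋₊, (σ 0 (n - h) : ℝ) * Λ n +
        ∑ k ∈ Finset.range k₀, TT (lamW h) h Q (X / 2 ^ (k + 1)) (fun n => (Λ n : ℝ)) := by
  classical
  unfold CoreSum
  rw [← Finset.sum_filter_add_sum_filter_not (Icc 1 Q) (fun q => Nat.Coprime q h)]
  have hcop : ∑ q ∈ (Icc 1 Q).filter (fun q => Nat.Coprime q h), |Tcorr h q X| ≤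
      ∑ n ∈ Ioc h ⌊X / 2 ^ k₀⌋₊, (σ 0 (n - h) : ℝ) * Λ n +
        ∑ k ∈ Finset.range k₀, TT (lamW h) h Q (X / 2 ^ (k + 1)) (fun n => (Λ n : ℝ)) := by
    change ∑ q ∈ moduli Q h, |Tcorr h q X| ≤ _
    calc ∑ q ∈ moduli Q h, |Tcorr h q X|
        ≤ ∑ q ∈ moduli Q h, (|InitSum h q ⌊X / 2 ^ k₀⌋₊| +
            ∑ k ∈ Finset.range k₀, |corr (lamW h) h q (X / 2 ^ (k + 1)) (fun n => (Λ n : ℝ))|) := by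
          refine Finset.sum_le_sum fun q _ => ?_
          rw [Tcorr_eq_init_add h q (by linarith) hk₀]
          exact (abs_add_le _ _).trans (add_le_add le_rfl (Finset.abs_sum_le_sum_abs _ _))
      _ = ∑ q ∈ moduli Q h, |InitSum h q ⌊X / 2 ^ k₀⌋₊| +
            ∑ k ∈ Finset.range k₀, TT (lamW h) h Q (X / 2 ^ (k + 1)) (fun n => (Λ n : ℝ)) := by
          rw [Finset.sum_add_distrib, Finset.sum_comm]; rfl
      _ ≤ _ := add_le_add (sum_abs_InitSum_le h Q _) le_rfl
  have hncop : ∑ q ∈ (Icc 1 Q).filter (fun q => ¬ Nat.Coprime q h), |Tcorr h q X| ≤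
      Q * (h * (Nat.log 2 ⌊X⌋₊ + 1) * Real.log X) := by
    calc ∑ q ∈ (Icc 1 Q).filter (fun q => ¬ Nat.Coprime q h), |Tcorr h q X|
        ≤ ∑ q ∈ (Icc 1 Q).filter (fun q => ¬ Nat.Coprime q h), (h * (Nat.log 2 ⌊X⌋₊ + 1) * Real.log X) :=
          Finset.sum_le_sum fun q hq => abs_Tcorr_le_of_not_coprime hh (Finset.mem_filter.1 hq).2 hX
      _ = ((Icc 1 Q).filter (fun q => ¬ Nat.Coprime q h)).card * (h * (Nat.log 2 ⌊X⌋₊ + 1) * Real.log X) := by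
          rw [Finset.sum_const, nsmul_eq_mul]
      _ ≤ Q * (h * (Nat.log 2 ⌊X⌋₊ + 1) * Real.log X) := by
          refine mul_le_mul_of_nonneg_right ?_ ?_
          · have := Finset.card_filter_le (Icc 1 Q) (fun q => ¬ Nat.Coprime q h)
            rw [Nat.card_Icc, Nat.add_sub_cancel] at this
            exact_mod_cast this
          · have := Real.log_nonneg hX; positivity
  linarith

end Summit.Parity.GeneralizedHardyLittlewood.Theorems.SieveToMAvg
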